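import Mathlib.Analysis.Calculus.BumpFunction.InnerProduct
import Mathlib.Analysis.Calculus.ContDiff.Basic
import Mathlib.Analysis.Calculus.FDeriv.Prod
import Mathlib.Analysis.Calculus.FDeriv.Add
import Mathlib.Analysis.Calculus.Deriv.Basic
import Mathlib.Topology.Piecewise
import Literature.Analysis.FunctionSpaces.TorusCalculus
import HarnessLib

/-!
# `C¹` extension of space–time fields from `[0, T₁) × 𝕋ᵈ` to `ℝ × 𝕋ᵈ` (reflection across `t = 0`)

Solution notions on the flat torus (`Torus.IsSmoothSpaceTimeOn (Ico 0 T₁) u`, the classical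
Euler/Navier–Stokes solutions of `Literature/Analysis/FluidPDE`) are smooth only on the half-open
time interval `[0, T₁)`, whereas the test functions consumed by weak / measure-valued formulations
(`CompressibleEuler.IsTestFunction φ := ContDiff ℝ 1 (stLift φ)`) must be `C¹` on all of
`ℝ × 𝕋ᵈ`. Weak–strong uniqueness arguments (Březina–Feireisl 2018, §3; Feireisl–Novotný 2012, §3)
plug smooth functions OF THE STRONG SOLUTION into the weak formulation, so one needs: a field that
is `C¹` on `[0, T₁) × 𝕋ᵈ` agrees on `[0, T'] × 𝕋ᵈ` (`T' < T₁`) with a globally `C¹` field.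

We give the elementary construction: reflect across `t = 0` by `φ̃(t) = 2 φ(0) - φ(-t)` for `t < 0`
(values and first derivatives match at `t = 0`), and multiply by a smooth time cut-off equal to `1`
on `[-T', T']` and supported in `(-T₁, T₁)`.

## Main results

* `Torus.reflectExt φ` — the reflected field;
* `Torus.contDiffOn_stLift_reflectExt` — it is `C¹` on `(-T₁, T₁) × 𝕋ᵈ` when `φ` is `C¹` on
  `[0, T₁) × 𝕋ᵈ`;
* `Torus.exists_contDiff_one_extension` — the global `C¹` extension agreeing with `φ` on
  `[0, T'] × 𝕋ᵈ` (and hence with the same two-sided time derivative on `(0, T')`).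

## References

* R. T. Seeley, *Extension of `C^∞` functions defined in a half space*, Proc. AMS 15 (1964)
  625–626 (the general reflection; only the first-order case is needed here).
* J. Březina, E. Feireisl, J. Math. Soc. Japan 70 (2018), §3 (where such test functions are used).
-/

open Set Filter Metric
open scoped Topology

namespace Literature.Analysis.FunctionSpaces

noncomputable section

namespace Torus

variable {d : Type*} [Fintype d] {F : Type*} [NormedAddCommGroup F] [NormedSpace ℝ F]

omit [Fintype d] in
/-- The first-order reflection of a space–time field across `t = 0`:
`reflectExt φ t = φ t` for `t ≥ 0` and `2 φ 0 - φ (-t)` for `t < 0` (Seeley-type reflection of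
order one: values and first time derivatives agree at `t = 0`). [folklore] -/
def reflectExt (φ : ℝ → UnitAddTorus d → F) (t : ℝ) (x : UnitAddTorus d) : F :=
  if 0 ≤ t then φ t x else (2 : ℝ) • φ 0 x - φ (-t) x

omit [Fintype d] in
/-- On `t ≥ 0` the reflection is the original field. [folklore] -/
@[simp] theorem reflectExt_of_nonneg (φ : ℝ → UnitAddTorus d → F) {t : ℝ} (ht : 0 ≤ t)
    (x : UnitAddTorus d) : reflectExt φ t x = φ t x := if_pos ht

omit [Fintype d] in
/-- On `t < 0` the reflection is `2 φ 0 - φ (-t)`. [folklore] -/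
theorem reflectExt_of_neg (φ : ℝ → UnitAddTorus d → F) {t : ℝ} (ht : t < 0) (x : UnitAddTorus d) :
    reflectExt φ t x = (2 : ℝ) • φ 0 x - φ (-t) x := if_neg (not_le.2 ht)

/-- The linear map `(t, v) ↦ (0, v)` of `ℝ × ℝᵈ` (projection onto the initial time slice). [folklore] -/
def sliceZeroCLM (d : Type*) [Fintype d] :
    ℝ × EuclideanSpace ℝ d →L[ℝ] ℝ × EuclideanSpace ℝ d :=
  (0 : ℝ × EuclideanSpace ℝ d →L[ℝ] ℝ).prod (ContinuousLinearMap.snd ℝ ℝ (EuclideanSpace ℝ d))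

/-- The linear map `(t, v) ↦ (-t, v)` of `ℝ × ℝᵈ` (time reflection). [folklore] -/
def timeReflectCLM (d : Type*) [Fintype d] :
    ℝ × EuclideanSpace ℝ d →L[ℝ] ℝ × EuclideanSpace ℝ d :=
  (-ContinuousLinearMap.fst ℝ ℝ (EuclideanSpace ℝ d)).prod
    (ContinuousLinearMap.snd ℝ ℝ (EuclideanSpace ℝ d))

/-- `sliceZeroCLM d (t, v) = (0, v)`. [folklore] -/
@[simp] theorem sliceZeroCLM_apply (p : ℝ × EuclideanSpace ℝ d) :
    sliceZeroCLM d p = (0, p.2) := rfl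

/-- `timeReflectCLM d (t, v) = (-t, v)`. [folklore] -/
@[simp] theorem timeReflectCLM_apply (p : ℝ × EuclideanSpace ℝ d) :
    timeReflectCLM d p = (-p.1, p.2) := rfl

/-- The key algebraic identity behind first-order reflection: for any linear map `M` on `ℝ × ℝᵈ`,
`2 M ∘ (0, ·) - M ∘ (-(·), ·) = M`. [folklore] -/
theorem two_smul_comp_sliceZero_sub_comp_timeReflect
    (M : ℝ × EuclideanSpace ℝ d →L[ℝ] F) :
    (2 : ℝ) • M.comp (sliceZeroCLM d) - M.comp (timeReflectCLM d) = M := by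
  refine ContinuousLinearMap.ext fun q => ?_
  obtain ⟨τ, v⟩ := q
  have e1 : ((-τ, v) : ℝ × EuclideanSpace ℝ d) = (0, v) - (τ, 0) := by ext <;> simp
  have e2 : ((τ, v) : ℝ × EuclideanSpace ℝ d) = (τ, 0) + (0, v) := by ext <;> simp
  simp only [FunLike.coe_sub, FunLike.coe_smul, Pi.sub_apply,
    Pi.smul_apply, ContinuousLinearMap.comp_apply, sliceZeroCLM_apply, timeReflectCLM_apply]
  rw [e1, map_sub, e2, map_add, two_smul]
  abel

/-- The space–time lift of the reflection, on `t ≤ 0`, is `2 φ̂(0, ·) - φ̂(-t, ·)`. [folklore] -/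
theorem stLift_reflectExt_of_nonpos (φ : ℝ → UnitAddTorus d → F)
    {p : ℝ × EuclideanSpace ℝ d} (hp : p.1 ≤ 0) :
    stLift (reflectExt φ) p =
      (2 : ℝ) • stLift φ (sliceZeroCLM d p) - stLift φ (timeReflectCLM d p) := by
  rcases hp.lt_or_eq with h | h
  · simp [stLift, reflectExt_of_neg φ h]
  · simp [stLift, h, two_smul]

omit [Fintype d] in
/-- The space–time lift of the reflection, on `t ≥ 0`, is the lift of `φ`. [folklore] -/
theorem stLift_reflectExt_of_nonneg (φ : ℝ → UnitAddTorus d → F)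
    {p : ℝ × EuclideanSpace ℝ d} (hp : 0 ≤ p.1) :
    stLift (reflectExt φ) p = stLift φ p := by
  simp [stLift, hp]

/-- **The reflection of a `C¹` field on `[0, T₁) × 𝕋ᵈ` is `C¹` on `(-T₁, T₁) × 𝕋ᵈ`.**
Values agree at `t = 0` by construction; the one-sided derivatives at `t = 0` are `L` (from the
right) and `2 L ∘ (0,·) - L ∘ (-(·),·) = L` (from the left), so they glue
(`HasFDerivWithinAt.union`), and the glued derivative is continuous (`ContinuousOn.if`). [folklore] -/
theorem contDiffOn_stLift_reflectExt {φ : ℝ → UnitAddTorus d → F} {T₁ : ℝ} (hT₁ : 0 < T₁)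
    (hφ : ContDiffOn ℝ 1 (stLift φ) (Ico 0 T₁ ×ˢ univ)) :
    ContDiffOn ℝ 1 (stLift (reflectExt φ)) (Ioo (-T₁) T₁ ×ˢ univ) := by
  -- notation
  set A := sliceZeroCLM d with hA_def
  set B := timeReflectCLM d with hB_def
  set s : Set (ℝ × EuclideanSpace ℝ d) := Ico 0 T₁ ×ˢ univ with hs_def
  set S : Set (ℝ × EuclideanSpace ℝ d) := Ioo (-T₁) T₁ ×ˢ univ with hS_def
  set f := stLift (reflectExt φ) with hf_def
  set L : ℝ × EuclideanSpace ℝ d → (ℝ × EuclideanSpace ℝ d →L[ℝ] F) :=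
    fderivWithin ℝ (stLift φ) s with hL_def
  have hs_uniq : UniqueDiffOn ℝ s := (uniqueDiffOn_Ico 0 T₁).prod uniqueDiffOn_univ
  have hS_open : IsOpen S := isOpen_Ioo.prod isOpen_univ
  have hmem_s : ∀ {p : ℝ × EuclideanSpace ℝ d}, 0 ≤ p.1 → p.1 < T₁ → p ∈ s :=
    fun h0 hT => ⟨⟨h0, hT⟩, mem_univ _⟩
  have h1 : ∀ p ∈ s, HasFDerivWithinAt (stLift φ) (L p) s p := fun p hp =>
    ((hφ.differentiableOn one_ne_zero) p hp).hasFDerivWithinAt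
  have h2 : ContinuousOn L s := hφ.continuousOn_fderivWithin hs_uniq le_rfl
  -- interior points of `s`: honest derivative
  have h1' : ∀ p : ℝ × EuclideanSpace ℝ d, 0 < p.1 → p.1 < T₁ →
      HasFDerivAt (stLift φ) (L p) p := by
    intro p h0 hT
    refine (h1 p (hmem_s h0.le hT)).hasFDerivAt (Filter.mem_of_superset
      ((isOpen_Ioo.prod isOpen_univ).mem_nhds
        (show p ∈ Ioo 0 T₁ ×ˢ univ from ⟨⟨h0, hT⟩, mem_univ _⟩)) ?_)
    rintro q ⟨⟨hq0, hqT⟩, -⟩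
    exact hmem_s hq0.le hqT
  have hA_mem : ∀ p : ℝ × EuclideanSpace ℝ d, A p ∈ s := fun p => hmem_s le_rfl hT₁
  -- the composite `q ↦ φ̂ (0, q.2)` is differentiable everywhere
  have hA_at : ∀ p : ℝ × EuclideanSpace ℝ d,
      HasFDerivAt (fun q => stLift φ (A q)) ((L (A p)).comp A) p := fun p =>
    (h1 (A p) (hA_mem p)).comp_hasFDerivAt p A.hasFDerivAt
      (Filter.Eventually.of_forall fun q => hA_mem q)
  -- the glued derivative and the negative-side representative
  set f' : ℝ × EuclideanSpace ℝ d → (ℝ × EuclideanSpace ℝ d →L[ℝ] F) := fun p =>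
    if 0 ≤ p.1 then L p else (2 : ℝ) • (L (A p)).comp A - (L (B p)).comp B with hf'_def
  set g : ℝ × EuclideanSpace ℝ d → F := fun p =>
    (2 : ℝ) • stLift φ (A p) - stLift φ (B p) with hg_def
  have hg_eq : ∀ p : ℝ × EuclideanSpace ℝ d, p.1 ≤ 0 → f p = g p := fun p hp =>
    stLift_reflectExt_of_nonpos φ hp
  -- `HasFDerivAt` everywhere on `S`
  have hderiv : ∀ p ∈ S, HasFDerivAt f (f' p) p := by
    rintro p ⟨⟨hlo, hhi⟩, -⟩
    rcases lt_trichotomy p.1 0 with hneg | hzero | hpos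
    · -- `p.1 < 0`: `f = g` near `p`, and `g` is differentiable at `p`
      have hfg : f =ᶠ[𝓝 p] g := by
        filter_upwards [(isOpen_lt continuous_fst continuous_const).mem_nhds hneg] with q hq
        exact hg_eq q (le_of_lt hq)
      have hBp : HasFDerivAt (stLift φ) (L (B p)) (B p) :=
        h1' (B p) (by simpa [hB_def] using hneg) (by simpa [hB_def] using neg_lt.2 hlo)
      have hB_at : HasFDerivAt (fun q => stLift φ (B q)) ((L (B p)).comp B) p :=
        hBp.comp p B.hasFDerivAt
      have hg' : HasFDerivAt g ((2 : ℝ) • (L (A p)).comp A - (L (B p)).comp B) p :=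
        ((hA_at p).const_smul (2 : ℝ)).sub hB_at
      have : f' p = (2 : ℝ) • (L (A p)).comp A - (L (B p)).comp B := if_neg (not_le.2 hneg)
      rw [this]
      exact hg'.congr_of_eventuallyEq hfg
    · -- `p.1 = 0`: glue the one-sided derivatives
      have hp_s : p ∈ s := hmem_s hzero.ge (by rw [hzero]; exact hT₁)
      have hAp : A p = p := Prod.ext hzero.symm rfl
      have hBp : B p = p := Prod.ext (by simp [hB_def, hzero]) rfl
      have hf'p : f' p = L p := if_pos hzero.ge
      -- right derivative
      have hplus : HasFDerivWithinAt f (L p) {q | 0 ≤ q.1} p := by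
        have hsplit : s = {q : ℝ × EuclideanSpace ℝ d | 0 ≤ q.1} ∩ Iio T₁ ×ˢ univ := by
          ext q; simp [hs_def, Ico]
        have hnhds : (Iio T₁ ×ˢ univ : Set (ℝ × EuclideanSpace ℝ d)) ∈ 𝓝 p :=
          (isOpen_Iio.prod isOpen_univ).mem_nhds ⟨by simpa [hzero] using hT₁, mem_univ _⟩
        have h := h1 p hp_s
        rw [hsplit, hasFDerivWithinAt_inter hnhds] at h
        exact h.congr (fun q hq => stLift_reflectExt_of_nonneg φ hq)
          (stLift_reflectExt_of_nonneg φ hzero.ge)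
      -- left derivative
      have hminus : HasFDerivWithinAt f (L p) {q | q.1 ≤ 0} p := by
        set tneg : Set (ℝ × EuclideanSpace ℝ d) := (Ioi (-T₁) ∩ Iic 0) ×ˢ univ with htneg
        have hBmaps : MapsTo B tneg s := by
          rintro q ⟨⟨hq1, hq2⟩, -⟩
          exact hmem_s (by simpa [hB_def] using hq2) (by simpa [hB_def] using neg_lt.2 hq1)
        have hB_within : HasFDerivWithinAt (fun q => stLift φ (B q)) ((L (B p)).comp B) tneg p :=
          (h1 (B p) (hBp.symm ▸ hp_s)).comp p B.hasFDerivAt.hasFDerivWithinAt hBmaps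
        have hg_within : HasFDerivWithinAt g
            ((2 : ℝ) • (L (A p)).comp A - (L (B p)).comp B) tneg p :=
          (((hA_at p).hasFDerivWithinAt).const_smul (2 : ℝ)).sub hB_within
        rw [hAp, hBp, two_smul_comp_sliceZero_sub_comp_timeReflect] at hg_within
        have hf_within : HasFDerivWithinAt f (L p) tneg p :=
          hg_within.congr (fun q hq => hg_eq q hq.1.2) (hg_eq p hzero.le)
        have hsplit : tneg = {q : ℝ × EuclideanSpace ℝ d | q.1 ≤ 0} ∩ Ioi (-T₁) ×ˢ univ := by
          ext q; simp [htneg, and_comm]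
        have hnhds : (Ioi (-T₁) ×ˢ univ : Set (ℝ × EuclideanSpace ℝ d)) ∈ 𝓝 p :=
          (isOpen_Ioi.prod isOpen_univ).mem_nhds ⟨by simpa [hzero] using hT₁, mem_univ _⟩
        rwa [hsplit, hasFDerivWithinAt_inter hnhds] at hf_within
      have hunion := hplus.union hminus
      have huniv : ({q : ℝ × EuclideanSpace ℝ d | 0 ≤ q.1} ∪ {q | q.1 ≤ 0}) = univ :=
        eq_univ_of_forall fun q => (le_total 0 q.1).elim Or.inl Or.inr
      rw [huniv, hasFDerivWithinAt_univ] at hunion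
      rwa [hf'p]
    · -- `p.1 > 0`: `f = φ̂` near `p`
      have hfφ : f =ᶠ[𝓝 p] stLift φ := by
        filter_upwards [(isOpen_lt continuous_const continuous_fst).mem_nhds hpos] with q hq
        exact stLift_reflectExt_of_nonneg φ (le_of_lt hq)
      have : f' p = L p := if_pos hpos.le
      rw [this]
      exact (h1' p hpos hhi).congr_of_eventuallyEq hfφ
  -- continuity of the glued derivative on `S`
  have hcont : ContinuousOn f' S := by
    have hclos_neg : closure {q : ℝ × EuclideanSpace ℝ d | ¬0 ≤ q.1} ⊆ {q | q.1 ≤ 0} := by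
      refine closure_minimal (fun q hq => le_of_lt (not_le.1 hq)) ?_
      exact isClosed_le continuous_fst continuous_const
    have hclos_pos : closure {q : ℝ × EuclideanSpace ℝ d | 0 ≤ q.1} = {q | 0 ≤ q.1} :=
      (isClosed_le continuous_const continuous_fst).closure_eq
    refine ContinuousOn.if ?_ ?_ ?_
    · -- agreement on the interface `t = 0`
      rintro q ⟨-, hq⟩
      rw [frontier_eq_closure_inter_closure, hclos_pos] at hq
      have hq0 : q.1 = 0 := le_antisymm (hclos_neg hq.2) hq.1
      have hAq : A q = q := Prod.ext hq0.symm rfl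
      have hBq : B q = q := Prod.ext (by simp [hB_def, hq0]) rfl
      rw [hAq, hBq, two_smul_comp_sliceZero_sub_comp_timeReflect]
    · -- `t ≥ 0` side
      rw [hclos_pos]
      refine h2.mono ?_
      rintro q ⟨⟨⟨-, hqT⟩, -⟩, hq0⟩
      exact hmem_s hq0 hqT
    · -- `t ≤ 0` side
      have hsub : S ∩ closure {q : ℝ × EuclideanSpace ℝ d | ¬0 ≤ q.1} ⊆
          (Ioi (-T₁) ∩ Iic 0) ×ˢ univ := by
        rintro q ⟨⟨⟨hq1, -⟩, -⟩, hq2⟩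
        exact ⟨⟨hq1, hclos_neg hq2⟩, mem_univ _⟩
      refine ContinuousOn.mono ?_ hsub
      have hLA : ContinuousOn (fun q => L (A q)) ((Ioi (-T₁) ∩ Iic 0) ×ˢ univ) :=
        h2.comp A.continuous.continuousOn fun q _ => hA_mem q
      have hLB : ContinuousOn (fun q => L (B q)) ((Ioi (-T₁) ∩ Iic 0) ×ˢ univ) := by
        refine h2.comp B.continuous.continuousOn ?_
        rintro q ⟨⟨hq1, hq2⟩, -⟩
        exact hmem_s (by simpa [hB_def] using hq2) (by simpa [hB_def] using neg_lt.2 hq1)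
      exact ((hLA.clm_comp continuousOn_const).const_smul (2 : ℝ)).sub
        (hLB.clm_comp continuousOn_const)
  -- assemble: `C¹` on the open set `S`
  rw [show (1 : WithTop ℕ∞) = 0 + 1 from (zero_add 1).symm,
    contDiffOn_succ_iff_hasFDerivWithinAt_of_uniqueDiffOn hS_open.uniqueDiffOn]
  refine ⟨fun h => ?_, f', contDiffOn_zero.2 hcont, fun p hp => (hderiv p hp).hasFDerivWithinAt⟩
  exact absurd h (by decide)

/-- **`C¹` extension from `[0, T₁) × 𝕋ᵈ`.** A field `φ : ℝ → 𝕋ᵈ → F` whose space–time lift is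
`C¹` on `[0, T₁) × ℝᵈ` agrees on `[0, T'] × 𝕋ᵈ` (any `0 < T' < T₁`) with a field `ψ` whose lift is
`C¹` on all of `ℝ × ℝᵈ` (so `ψ` is an admissible test function for the weak/measure-valued
formulations on the torus); in particular the two-sided time derivative of `ψ` on `(0, T')` is
that of `φ`. Construction: time cut-off times `reflectExt φ`. [folklore] -/
theorem exists_contDiff_one_extension {φ : ℝ → UnitAddTorus d → F} {T₁ T' : ℝ}
    (hφ : ContDiffOn ℝ 1 (stLift φ) (Ico 0 T₁ ×ˢ univ)) (hT' : 0 < T') (hT : T' < T₁) :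
    ∃ ψ : ℝ → UnitAddTorus d → F, ContDiff ℝ 1 (stLift ψ) ∧
      (∀ t ∈ Icc 0 T', ∀ x, ψ t x = φ t x) ∧
      (∀ t ∈ Ioo 0 T', ∀ x, timeDeriv ψ t x = timeDeriv φ t x) := by
  have hT₁ : 0 < T₁ := hT'.trans hT
  -- smooth time cut-off: `1` on `[-T', T']`, supported in the open ball of radius `(T' + T₁)/2`
  let χ : ContDiffBump (0 : ℝ) :=
    { rIn := T'
      rOut := (T' + T₁) / 2
      rIn_pos := hT'
      rIn_lt_rOut := by linarith }
  have hχ_one : ∀ t ∈ Icc 0 T', (χ : ℝ → ℝ) t = 1 := fun t ht =>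
    χ.one_of_mem_closedBall (by
      rw [mem_closedBall, dist_zero_right, Real.norm_eq_abs, abs_of_nonneg ht.1]; exact ht.2)
  have hχ_zero : ∀ t : ℝ, T₁ ≤ |t| → (χ : ℝ → ℝ) t = 0 := fun t ht =>
    χ.zero_of_le_dist (by
      rw [dist_zero_right, Real.norm_eq_abs]
      exact le_trans (by show (T' + T₁) / 2 ≤ T₁; linarith) ht)
  refine ⟨fun t x => (χ : ℝ → ℝ) t • reflectExt φ t x, ?_, ?_, ?_⟩
  · -- global `C¹`
    have hrefl := contDiffOn_stLift_reflectExt hT₁ hφ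
    have hlift : stLift (fun t x => (χ : ℝ → ℝ) t • reflectExt φ t x) =
        fun p => (χ : ℝ → ℝ) p.1 • stLift (reflectExt φ) p := rfl
    rw [hlift]
    refine contDiff_iff_contDiffAt.2 fun p => ?_
    by_cases hp : |p.1| < T₁
    · have hS : (Ioo (-T₁) T₁ ×ˢ univ : Set (ℝ × EuclideanSpace ℝ d)) ∈ 𝓝 p :=
        (isOpen_Ioo.prod isOpen_univ).mem_nhds ⟨abs_lt.1 hp, mem_univ _⟩
      exact ((χ.contDiff.comp contDiff_fst).contDiffAt).smul (hrefl.contDiffAt hS)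
    · -- outside `|t| < T₁` the product vanishes identically near `p`
      have hzero : (fun q : ℝ × EuclideanSpace ℝ d =>
          (χ : ℝ → ℝ) q.1 • stLift (reflectExt φ) q) =ᶠ[𝓝 p] fun _ => 0 := by
        have hlt : (T' + T₁) / 2 < |p.1| := lt_of_lt_of_le (by linarith) (not_lt.1 hp)
        filter_upwards [(isOpen_lt continuous_const (continuous_abs.comp continuous_fst)).mem_nhds
          hlt] with q hq
        have : (χ : ℝ → ℝ) q.1 = 0 := χ.zero_of_le_dist (by
          rw [dist_zero_right, Real.norm_eq_abs]; exact le_of_lt hq)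
        simp [this]
      exact (contDiffAt_const (c := (0 : F))).congr_of_eventuallyEq hzero
  · intro t ht x
    simp [hχ_one t ht, reflectExt_of_nonneg φ ht.1]
  · intro t ht x
    have heq : (fun τ => (χ : ℝ → ℝ) τ • reflectExt φ τ x) =ᶠ[𝓝 t] fun τ => φ τ x := by
      filter_upwards [isOpen_Ioo.mem_nhds ht] with τ hτ
      simp [hχ_one τ ⟨hτ.1.le, hτ.2.le⟩, reflectExt_of_nonneg φ hτ.1.le]
    exact heq.deriv_eq

/-- The extension lemma in the vocabulary of the solution notions: a field that is jointly smooth on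
`[0, T₁) × 𝕋ᵈ` (`IsSmoothSpaceTimeOn (Ico 0 T₁)`) has, for every `0 < T' < T₁`, a globally `C¹`
modification off `[0, T'] × 𝕋ᵈ`. [folklore] -/
theorem IsSmoothSpaceTimeOn.exists_contDiff_one_extension {u : ℝ → UnitAddTorus d → F}
    {T₁ T' : ℝ} (hu : IsSmoothSpaceTimeOn (Ico 0 T₁) u) (hT' : 0 < T') (hT : T' < T₁) :
    ∃ ψ : ℝ → UnitAddTorus d → F, ContDiff ℝ 1 (stLift ψ) ∧
      (∀ t ∈ Icc 0 T', ∀ x, ψ t x = u t x) ∧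
      (∀ t ∈ Ioo 0 T', ∀ x, timeDeriv ψ t x = timeDeriv u t x) :=
  Torus.exists_contDiff_one_extension (hu.of_le (by exact_mod_cast le_top)) hT' hT

end Torus

end

end Literature.Analysis.FunctionSpaces
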